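import Summits.ABC.IUTFork.Cor312HullDefinedDHVol
import Literature.IUT.LogVolume.CompletionLocalFieldsUnramified
import HarnessLib

/-!
# [IUTchIII] Corollary 3.12, statement — `ThetaFinite` for the real setting with the verbatim volumes, from
# THREE transparent conditions on the Θ-boxes (good primes: local Θ-volume `0`)

Record-only file (D-0012) of the abc-iut cell (Cor. 3.12 sub-crew, seat abc-iut-c312-5, gen 3; D-0067 TEAM A row
A-0 «finiteness + BridgeHyps at the real setting» — closes the named leftover `ThetaFinite` of gen 2's
`Real.bridgeHyps_settingDHVol` modulo conditions on the Θ-box binder only; REAL-INSTANCE half, the generic half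
is abc-iut-c312-7's `Cor312ThetaFiniteReal`); TAKES NO SIDE. [IUTchIII] Cor. 3.12 (kurims
`paper:url-4b091feeb646` p. 173 l. 41 – p. 174 l. 19), proof p. 175 l. 2–4: "one concludes easily from the
[easily verified] compactness of the `^{1,∘}𝒰_{j,v_ℚ}` … that the quantity `−|log(Θ)|` is finite"; [IUTchIV]
Thm. 1.10 Step (vi), p. 29: at the places of odd residue characteristic where `K` is absolutely unramified "the
“container of possible images” is precisely equal to the tensor product of log-shells", of log-volume `0`.
For c312-5's `Real.settingDHVol` (the setting of Cor. 3.12 over the real Dupuy–Hilado-level log-shells of `F`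
with the VERBATIM container of [IUTchIII] Rmk. 3.1.1 (ii)(iii); Θ-boxes a BINDER `thetaBox`) this file PROVES:

* GOOD PRIMES (`thetaHull_settingDHVol_eq_of_good`, `thetaLocal_settingDHVol_eq_zero`): at `p > 2`,
  `p ∤ disc(F)` (every `F_v`, `v | p`, absolutely unramified — abc-iut-c312-3
  `absRamificationIdx_rescaledCompletion_eq_one_of_not_dvd_discr`), if the union of the Θ-boxes at `(j, p)`,
  `j ∈ 𝔽_l^⋇`, IS the unit polydisc `𝒪_L` (the trivial line bundle), then the holomorphic hull of the union of ALL
  possible images is `e⁻¹(Π_{v⃗} I_{v⃗}) = e⁻¹(Π_{v⃗} (R_{v⃗})^∼)` and the local Θ-volume is `0`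
  (c312-5 `latticeF_one_eq_hullSet_of_unramified`, c312-3 `packetLogμ_normalizedPacket`);
* `thetaFinite_settingDHVol`: c312-7's `ThetaFinite` ⟸ Θ-boxes bounded and nondegenerate at every prime
  (companion `Cor312HullDefinedDHVol`) and equal to the unit polydisc off a finite set of primes (the primes
  dividing `2·disc(F)` are finitely many: `NumberField.discr_ne_zero`);
* companion `Cor312BridgeHypsDHVol`: the (Ind3)-region admissible with finitely supported log-volume, and c312-6's
  `BridgeHyps` for `Real.settingDHVol` with ALL fields discharged from five Θ-box conditions. What these
  conditions mean for the Θ-pilot object of [IUTchIII] Def. 3.8 (i) is the box provider's statement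
  (abc-iut-c312-3 `Ind3Datum`, Dupuy–Hilado (4.10)); nothing here asserts them.
[claim: Mochizuki2012, status: disputed] for the quoted sentences; [cite: DupuyHilado2025, §4 (intro), §4.10];
[cite: Mochizuki2012, IUTchIV Thm 1.10 proof Step (vi) p. 29]. Deliberately NOT here: the Statement of Cor. 3.12
or any reading of Step (xi) (TEAM A/B rows), any judgement.
-/

noncomputable section

open Set Function NumberField IsDedekindDomain Bornology
open scoped Pointwise

namespace Summit.ABC

namespace IUTFork

namespace Thm311

namespace Real

open Cor312 Cor312Vol Literature.IUT.LogThetaLattice Literature.IUT.LogVolume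

variable {F : Type} [Field F] [NumberField F] (X : PilotData F) {logv : PadicLogs F} (hlog : LogvAnalytic logv)

/-! ## 0. The fields of the presentation are absolutely unramified off `disc(F)`; label cardinalities -/

/-- **Every `F_v`, `v | p`, of c312-5's presentation is absolutely unramified when `p ∤ disc(F)`** (its `K_v` IS
abc-iut-S7's rescaled completion; Dedekind's discriminant theorem via abc-iut-c312-3).
[cite: NeukirchANT1999, Ch. III Thm. (2.12)] -/
theorem absRamificationIdx_presAt_eq_one (pp : Nat.Primes) (hdisc : ¬ ((pp : ℕ) : ℤ) ∣ NumberField.discr F)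
    (v : (thetaIndex X).Fibre (.inr pp)) :
    haveI : Fact (pp : ℕ).Prime := ⟨pp.2⟩
    absRamificationIdx (pp : ℕ) ((presAt X hlog pp).k v) = 1 := by
  haveI : Fact (pp : ℕ).Prime := ⟨pp.2⟩
  exact absRamificationIdx_rescaledCompletion_eq_one_of_not_dvd_discr F pp.1 (placeOf X pp.1 v)
    (natCast_mem_placeOf X pp.1 v) hdisc

/-- The `(j+1)`-capsule at a label `j = i + 1 ∈ 𝔽_l^⋇` has at least two members. [folklore] -/
theorem two_le_card_caps_labelSucc (i : Fin (thetaIndex X).lstar) :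
    2 ≤ Fintype.card ((thetaIndex X).Caps (Setting.labelSucc i)) := by
  rw [show Fintype.card ((thetaIndex X).Caps (Setting.labelSucc i)) = (Setting.labelSucc (T := thetaIndex X) i : ℕ) + 1
    from Fintype.card_fin _, Setting.labelSucc, Fin.val_succ]
  omega

section Setting

variable (M : Type) [Field M] [NumberField M]
  (archPk : ∀ (j : (thetaIndex X).Label) (vQ : (thetaIndex X).VQ), Set ((logShellsDH X logv).Packet j vQ))
  (archSub : ∀ (j : (thetaIndex X).Label) (v : (thetaIndex X).V),
    Set ((logShellsDH X logv).Packet j ((thetaIndex X).over v)))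
  (Ψ : ℤ → ∀ v : (thetaIndex X).V, v ∈ (thetaIndex X).Vbad → Set ((logShellsDH X logv).StarPacket v))
  (act : ℤ → ∀ v : (thetaIndex X).V, v ∈ (thetaIndex X).Vbad →
    (logShellsDH X logv).StarPacket v → Module.End ℚ ((logShellsDH X logv).StarPacket v))
  (Mmod : ℤ → ∀ j : (thetaIndex X).LabelStar, Set ((logShellsDH X logv).GlobalPacket j.1))
  (region : ℤ → ∀ j : (thetaIndex X).LabelStar, FinDivisor M → ∀ vQ : (thetaIndex X).VQ,
    Set ((logShellsDH X logv).Packet j.1 vQ))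
  (n : ℤ) {HT : Type} {LogLink : HT → HT → Type} {IsFull : ∀ {s t : HT}, LogLink s t → Prop}
  (lat : LGPGaussianLogThetaLattice LogLink IsFull)
  {Frd : Type} {IsoF : Frd → Frd → Type} {Ob : Frd → Type} {realify : Frd → Frd} {Strip : Type}
  {IsoS : Strip → Strip → Type} {Mv : ∀ v : (thetaIndex X).V, v ∈ (thetaIndex X).Vbad → Type}
  [∀ v h, Monoid (Mv v h)]
  (sig : GlobalLGPFrobenioidSignature (thetaIndex X).lstar (thetaIndex X).V (· ∈ (thetaIndex X).Vbad)
    Frd IsoF Ob realify Strip IsoS Mv)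
  (split : SplittingMonoids Mv) {ObΔ : Type} {N : ∀ v : (thetaIndex X).V, v ∈ (thetaIndex X).Vbad → Type}
  [∀ v h, Monoid (N v h)] (qData : QPilotData ObΔ N)
  (thetaBox : ℤ → Ob sig.Clgp → ∀ (j : (thetaIndex X).Label) (vQ : (thetaIndex X).VQ),
    Set (∀ s : factorIdxDH X hlog j vQ, factorFieldDH X hlog j vQ s))
  (qCentre : ObΔ → ∀ (j : (thetaIndex X).Label) (vQ : (thetaIndex X).VQ),
    ∀ s : factorIdxDH X hlog j vQ, factorFieldDH X hlog j vQ s)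
  (hq : ∀ j vQ s, qCentre (qPilotObject qData) j vQ s ≠ 0)
  (hfin : ∀ j : (thetaIndex X).Label, (Function.support fun vQ =>
    ((situationDHVol X hlog M archPk archSub Ψ act Mmod region).D n).logvol j vQ
      (factorMapDH X hlog j vQ ⁻¹' hullSet (factorFieldDH X hlog j vQ) (qCentre (qPilotObject qData) j vQ))).Finite)

/-! ## 1. Good primes: the hull of the union of the possible images is `e⁻¹(Π_{v⃗} (R_{v⃗})^∼)`, of volume `0` -/

/-- The log-volume of `e⁻¹(Π_{v⃗} (R_{v⃗})^∼)` in the verbatim container VANISHES at every prime (normalisation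
`log μ̄((R)^∼) = 0`, Dupuy–Hilado (3.6)). [cite: DupuyHilado2025, Def. 3.6.1] -/
theorem logvol_preimage_normalizedPacket_settingDHVol (j : (thetaIndex X).Label) (pp : Nat.Primes) :
    haveI : Fact (pp : ℕ).Prime := ⟨pp.2⟩
    ((situationDHVol X hlog M archPk archSub Ψ act Mmod region).D n).logvol j (.inr pp)
      ((presAt X hlog pp).comparison j ⁻¹' Set.pi univ fun e =>
        (normalizedPacket (pp : ℕ) ((presAt X hlog pp).kk e) : Set ((presAt X hlog pp).X e))) = 0 := by
  haveI : Fact (pp : ℕ).Prime := ⟨pp.2⟩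
  haveI : Nonempty ((thetaIndex X).Caps j) := ⟨0⟩
  refine ((realizes_situationDHVol X hlog M archPk archSub Ψ act Mmod region n).logvol_eq j (.inr pp) _).trans ?_
  have h := SummandPieces.logvol_preimage_pi (summandPiecesDH X hlog) j (.inr pp)
    (R := fun e => (normalizedPacket (pp : ℕ) ((presAt X hlog pp).kk e) : Set ((presAt X hlog pp).X e)))
    (fun e => (presAt X hlog pp).packetAdm_normalizedPacket_kk e)
  refine h.trans (Finset.sum_eq_zero fun e _ => ?_)
  show (summandPiecesDH X hlog).w j (.inr pp) e *
    packetLogμ (pp : ℕ) ((presAt X hlog pp).kk e) (normalizedPacket (pp : ℕ) ((presAt X hlog pp).kk e)) = 0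
  rw [packetLogμ_normalizedPacket, mul_zero]

/-- … and `e⁻¹(Π_{v⃗} (R_{v⃗})^∼)` is ADMISSIBLE there. [cite: DupuyHilado2025, Def. 3.6.1] -/
theorem adm_preimage_normalizedPacket_settingDHVol (j : (thetaIndex X).Label) (pp : Nat.Primes) :
    haveI : Fact (pp : ℕ).Prime := ⟨pp.2⟩
    ((situationDHVol X hlog M archPk archSub Ψ act Mmod region).D n).Adm j (.inr pp)
      ((presAt X hlog pp).comparison j ⁻¹' Set.pi univ fun e =>
        (normalizedPacket (pp : ℕ) ((presAt X hlog pp).kk e) : Set ((presAt X hlog pp).X e))) := by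
  haveI : Fact (pp : ℕ).Prime := ⟨pp.2⟩
  exact ⟨_, Set.image_preimage_eq _ ((presAt X hlog pp).comparison_surjective j),
    fun e => (presAt X hlog pp).packetAdm_normalizedPacket_kk e⟩

/-- The preimage under the field-factor comparison of the unit polydisc `𝒪_L = hullSet 1` IS
`e⁻¹(Π_{v⃗} (R_{v⃗})^∼)` — at EVERY prime (`ψ_{v⃗}((R_{v⃗})^∼) = Π_i 𝒪_{L_{v⃗,i}}`). [cite: Mochizuki2012, IUTchIV Prop. 1.4 (i) p. 13] -/
theorem preimage_factorMapDH_hullSet_one (j : (thetaIndex X).Label) (pp : Nat.Primes) :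
    haveI : Fact (pp : ℕ).Prime := ⟨pp.2⟩
    factorMapDH X hlog j (.inr pp) ⁻¹' hullSet (factorFieldDH X hlog j (.inr pp)) (fun _ => 1) =
      (presAt X hlog pp).comparison j ⁻¹' Set.pi univ fun e =>
        (normalizedPacket (pp : ℕ) ((presAt X hlog pp).kk e) : Set ((presAt X hlog pp).X e)) := by
  haveI : Fact (pp : ℕ).Prime := ⟨pp.2⟩
  haveI : Nonempty ((thetaIndex X).Caps j) := ⟨0⟩
  ext x
  simp only [Set.mem_preimage, Set.mem_univ_pi, SetLike.mem_coe]
  rw [hullSet, mem_polydisc]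
  constructor
  · intro h e
    have h1 : dEquiv (pp : ℕ) ((presAt X hlog pp).kk e) ((presAt X hlog pp).comparison j x e) ∈
        (piUnitBallStructure (DFac (pp : ℕ) ((presAt X hlog pp).kk e)) : Set _) := by
      rw [coe_piUnitBallStructure]
      refine (mem_polydisc _).2 fun i => ?_
      have h2 := h ⟨e, i⟩
      rw [norm_one] at h2
      exact h2
    rw [← image_normalizedPacket_eq_coe] at h1
    exact ((dEquiv (pp : ℕ) ((presAt X hlog pp).kk e)).injective.mem_set_image).1 h1
  · intro h s
    obtain ⟨e, i⟩ := s
    have h1 : dEquiv (pp : ℕ) ((presAt X hlog pp).kk e) ((presAt X hlog pp).comparison j x e) ∈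
        (piUnitBallStructure (DFac (pp : ℕ) ((presAt X hlog pp).kk e)) : Set _) := by
      rw [← image_normalizedPacket_eq_coe]
      exact ⟨_, h e, rfl⟩
    rw [coe_piUnitBallStructure] at h1
    have h2 := (mem_polydisc _).1 h1 i
    rw [norm_one]
    exact h2

/-- **At a GOOD prime the hull of the union of ALL possible images IS `e⁻¹(Π_{v⃗} I_{v⃗})`**: for `p > 2`,
`p ∤ disc(F)` and `j ∈ 𝔽_l^⋇`, if the union of the Θ-boxes at `(j, p)` is the unit polydisc `𝒪_L`, then
`^{n,∘}𝒰_{j,p} = e⁻¹(Π_{v⃗} I_{v⃗})` ([IUTchIV] Thm. 1.10 Step (vi): "the “container of possible images” is precisely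
equal to the tensor product of log-shells"): the (Ind1)/(Ind2)-orbit stays inside the lattice, the lattice IS
`e⁻¹(𝒪_L)` here (`latticeF_one_eq_hullSet_of_unramified`), and `𝒪_L` is its own hull.
[cite: Mochizuki2012, IUTchIV Thm 1.10 proof Step (vi) p. 29] -/
theorem thetaHull_settingDHVol_eq_of_good (i : Fin (thetaIndex X).lstar) (pp : Nat.Primes)
    (hp2 : 2 < (pp : ℕ)) (hdisc : ¬ ((pp : ℕ) : ℤ) ∣ NumberField.discr F)
    (hbox : (⋃ m : ℤ, thetaBox m (thetaPilotObject sig split) (Setting.labelSucc i) (.inr pp)) =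
      hullSet (factorFieldDH X hlog (Setting.labelSucc i) (.inr pp)) (fun _ => 1)) :
    haveI : Fact (pp : ℕ).Prime := ⟨pp.2⟩
    (settingDHVol X hlog M archPk archSub Ψ act Mmod region n lat sig split qData thetaBox qCentre
          hq hfin).thetaHull (Setting.labelSucc i) (.inr pp) =
      (presAt X hlog pp).latticePk (Setting.labelSucc i) 1 := by
  haveI : Fact (pp : ℕ).Prime := ⟨pp.2⟩
  have hj := two_le_card_caps_labelSucc X i
  have he := absRamificationIdx_presAt_eq_one X hlog pp hdisc
  -- the lattice `Π I_v⃗` IS `𝒪_L` here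
  have hΛ : (presAt X hlog pp).latticeF (Setting.labelSucc i) 1 =
      hullSet (factorFieldDH X hlog (Setting.labelSucc i) (.inr pp)) (fun _ => 1) :=
    (presAt X hlog pp).latticeF_one_eq_hullSet_of_unramified hp2 hj he
  have hHul : Literature.IUT.LogVolume.IsHullSet (factorFieldDH X hlog (Setting.labelSucc i) (.inr pp))
      (hullSet (factorFieldDH X hlog (Setting.labelSucc i) (.inr pp)) (fun _ => 1)) :=
    ⟨fun _ => 1, fun _ => one_ne_zero, rfl⟩
  -- the (Ind3)-region is `e⁻¹(𝒪_L) = latticePk 1`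
  have h3 :
      (settingDHVol X hlog M archPk archSub Ψ act Mmod region n lat sig split qData thetaBox qCentre
        hq hfin).thetaRegion3 (Setting.labelSucc i) (.inr pp) = (presAt X hlog pp).latticePk (Setting.labelSucc i) 1 := by
    rw [thetaRegion3_settingDHVol, hbox]
    exact (preimage_factorMapDH_hullSet_one X hlog _ pp).trans
      ((presAt X hlog pp).latticePk_one_eq_of_unramified hp2 hj he).symm
  -- the union of the possible images has image `𝒪_L`
  have hU : factorMapDH X hlog (Setting.labelSucc i) (.inr pp) ''
      ⋃₀
          (settingDHVol X hlog M archPk archSub Ψ act Mmod region n lat sig split qData thetaBox qCentre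
            hq hfin).possibleImages (Setting.labelSucc i) (.inr pp) =
      hullSet (factorFieldDH X hlog (Setting.labelSucc i) (.inr pp)) (fun _ => 1) := by
    apply Set.Subset.antisymm
    · have hsub : ⋃₀
        (settingDHVol X hlog M archPk archSub Ψ act Mmod region n lat sig split qData thetaBox qCentre
          hq hfin).possibleImages (Setting.labelSucc i) (.inr pp) ⊆
          (presAt X hlog pp).latticePk (Setting.labelSucc i) 1 :=
        (settingDHVol X hlog M archPk archSub Ψ act Mmod region n lat sig split qData thetaBox qCentre
              hq hfin).sUnion_possibleImages_subset
          (fun Φ hΦ => (presAt X hlog pp).family_image_latticePk hΦ _ 1) h3.le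
      rintro _ ⟨x, hx, rfl⟩
      rw [← hΛ]
      exact ⟨(presAt X hlog pp).comparison _ x, hsub hx, rfl⟩
    · rw [← hbox, ← image_thetaRegion3_settingDHVol_inr
        X hlog M archPk archSub Ψ act Mmod region n lat sig split qData thetaBox qCentre hq hfin _ pp]
      exact Set.image_mono (
          (settingDHVol X hlog M archPk archSub Ψ act Mmod region n lat sig split qData thetaBox qCentre
            hq hfin).thetaRegion3_subset_sUnion _ _)
  have hb : Bornology.IsBounded (factorMapDH X hlog (Setting.labelSucc i) (.inr pp) ''
      ⋃₀
          (settingDHVol X hlog M archPk archSub Ψ act Mmod region n lat sig split qData thetaBox qCentre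
            hq hfin).possibleImages (Setting.labelSucc i) (.inr pp)) := by
    rw [hU]
    exact isBounded_hullSet _ _
  -- compute the hull through c312-7's pulled-back real frame
  show ((HullFrame.ofLocalFields (factorFieldDH X hlog (Setting.labelSucc i) (.inr pp))).comap
      (factorMapDH X hlog (Setting.labelSucc i) (.inr pp))).hull
      (⋃₀
          (settingDHVol X hlog M archPk archSub Ψ act Mmod region n lat sig split qData thetaBox qCentre
            hq hfin).possibleImages (Setting.labelSucc i) (.inr pp)) = _
  rw [HullFrame.comap_hull _ _ hb, hU,
    HullFrame.ofLocalFields_hull_eq _ (isBounded_hullSet _ _) hHul.isNondegenerate, holomorphicHull_hullSet]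
  exact (preimage_factorMapDH_hullSet_one X hlog _ pp).trans
    ((presAt X hlog pp).latticePk_one_eq_of_unramified hp2 hj he).symm

/-- **At a GOOD prime the local Θ-volume is `0`** (the hull is `e⁻¹(Π_{v⃗} (R_{v⃗})^∼)`, of log-volume `0`).
[cite: Mochizuki2012, IUTchIV Thm 1.10 proof Step (vi) p. 29] -/
theorem thetaLocal_settingDHVol_eq_zero (i : Fin (thetaIndex X).lstar) (pp : Nat.Primes)
    (hp2 : 2 < (pp : ℕ)) (hdisc : ¬ ((pp : ℕ) : ℤ) ∣ NumberField.discr F)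
    (hbox : (⋃ m : ℤ, thetaBox m (thetaPilotObject sig split) (Setting.labelSucc i) (.inr pp)) =
      hullSet (factorFieldDH X hlog (Setting.labelSucc i) (.inr pp)) (fun _ => 1)) :
    (settingDHVol X hlog M archPk archSub Ψ act Mmod region n lat sig split qData thetaBox qCentre
          hq hfin).thetaLocal (Setting.labelSucc i) (.inr pp) = ((0 : ℝ) : WithTop ℝ) := by
  haveI : Fact (pp : ℕ).Prime := ⟨pp.2⟩
  have hHul : Literature.IUT.LogVolume.IsHullSet (factorFieldDH X hlog (Setting.labelSucc i) (.inr pp))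
      (hullSet (factorFieldDH X hlog (Setting.labelSucc i) (.inr pp)) (fun _ => 1)) :=
    ⟨fun _ => 1, fun _ => one_ne_zero, rfl⟩
  have hHD :
      (settingDHVol X hlog M archPk archSub Ψ act Mmod region n lat sig split qData thetaBox qCentre
        hq hfin).HullDefined (Setting.labelSucc i) (.inr pp) :=
    hullDefined_settingDHVol_inr
        X hlog M archPk archSub Ψ act Mmod region n lat sig split qData thetaBox qCentre hq hfin _ pp (by rw [hbox]; exact isBounded_hullSet _ _)
      (by rw [hbox]; exact hHul.isNondegenerate)
  unfold Setting.thetaLocal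
  rw [if_pos hHD, thetaHull_settingDHVol_eq_of_good
      X hlog M archPk archSub Ψ act Mmod region n lat sig split qData thetaBox qCentre hq hfin i pp hp2 hdisc hbox,
    (presAt X hlog pp).latticePk_one_eq_of_unramified hp2 (two_le_card_caps_labelSucc X i)
      (absRamificationIdx_presAt_eq_one X hlog pp hdisc)]
  exact congrArg _ (logvol_preimage_normalizedPacket_settingDHVol X hlog M archPk archSub Ψ act Mmod region n (Setting.labelSucc i) pp)

/-! ## 2. `ThetaFinite` -/

/-- The primes dividing a nonzero natural number form a finite set of `Nat.Primes`. [folklore] -/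
theorem finite_primes_dvd {D : ℕ} (hD : D ≠ 0) : {pp : Nat.Primes | (pp : ℕ) ∣ D}.Finite := by
  have hsub : {pp : Nat.Primes | (pp : ℕ) ∣ D} ⊆ (fun pp : Nat.Primes => (pp : ℕ)) ⁻¹' (D.divisors : Set ℕ) :=
    fun pp hpp => by simpa [Nat.mem_divisors] using And.intro hpp hD
  exact ((Finset.finite_toSet _).preimage Nat.Primes.coe_nat_injective.injOn).subset hsub

/-- A prime not dividing `2·|disc(F)|` is odd and does not divide `disc(F)`. [folklore] -/
theorem good_of_not_dvd (pp : Nat.Primes) (h : ¬ (pp : ℕ) ∣ 2 * (NumberField.discr F).natAbs) :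
    2 < (pp : ℕ) ∧ ¬ ((pp : ℕ) : ℤ) ∣ NumberField.discr F := by
  refine ⟨lt_of_le_of_ne pp.2.two_le fun h2 => h ?_, fun hd => h ?_⟩
  · rw [← h2]; exact dvd_mul_right 2 _
  · exact Dvd.dvd.mul_left (Int.natCast_dvd.1 hd) 2

/-- **`ThetaFinite` for the real setting with the verbatim volumes, from three Θ-box conditions**: bounded and
nondegenerate boxes at every `(j ∈ 𝔽_l^⋇, p)` (⇒ every local Θ-volume is a real number, `Cor312HullDefinedDHVol`),
and boxes equal to the unit polydisc off a finite prime set (⇒ zero local Θ-volume at every further prime not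
dividing `2·disc(F)`, so the global sum of Prop. 3.9 (iii) is a finite sum). [claim: Mochizuki2012, status: disputed] -/
theorem thetaFinite_settingDHVol
    (hbdd : ∀ (i : Fin (thetaIndex X).lstar) (pp : Nat.Primes),
      Bornology.IsBounded (⋃ m : ℤ, thetaBox m (thetaPilotObject sig split) (Setting.labelSucc i) (.inr pp)))
    (hnd : ∀ (i : Fin (thetaIndex X).lstar) (pp : Nat.Primes),
      IsNondegenerate (factorFieldDH X hlog (Setting.labelSucc i) (.inr pp))
        (⋃ m : ℤ, thetaBox m (thetaPilotObject sig split) (Setting.labelSucc i) (.inr pp)))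
    (hcof : ∀ i : Fin (thetaIndex X).lstar, {pp : Nat.Primes |
      (⋃ m : ℤ, thetaBox m (thetaPilotObject sig split) (Setting.labelSucc i) (.inr pp)) ≠
        hullSet (factorFieldDH X hlog (Setting.labelSucc i) (.inr pp)) (fun _ => 1)}.Finite) :
    (settingDHVol X hlog M archPk archSub Ψ act Mmod region n lat sig split qData thetaBox qCentre
          hq hfin).ThetaFinite := by
  refine ⟨fun i vQ => thetaLocal_ne_top_settingDHVol
      X hlog M archPk archSub Ψ act Mmod region n lat sig split qData thetaBox qCentre hq hfin (Setting.labelSucc i) (hbdd i) (hnd i) vQ,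
    fun i => ?_⟩
  have hD : 2 * (NumberField.discr F).natAbs ≠ 0 :=
    mul_ne_zero two_ne_zero (Int.natAbs_ne_zero.2 (NumberField.discr_ne_zero F))
  refine ((Set.finite_range Sum.inl).union (((finite_primes_dvd hD).union (hcof i)).image Sum.inr)).subset ?_
  intro vQ hvQ
  rcases vQ with u | pp
  · exact Or.inl ⟨u, rfl⟩
  · refine Or.inr ⟨pp, ?_, rfl⟩
    by_contra hpp
    simp only [Set.mem_union, Set.mem_setOf_eq, not_or, ne_eq, not_not] at hpp
    obtain ⟨hp2, hdisc⟩ := good_of_not_dvd (F := F) pp hpp.1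
    have h0 : (
        (settingDHVol X hlog M archPk archSub Ψ act Mmod region n lat sig split qData thetaBox qCentre
          hq hfin).thetaLocal (Setting.labelSucc i) (.inr pp)).untopD 0 = 0 := by
      rw [thetaLocal_settingDHVol_eq_zero
          X hlog M archPk archSub Ψ act Mmod region n lat sig split qData thetaBox qCentre hq hfin i pp hp2 hdisc hpp.2, WithTop.untopD_coe]
    exact absurd h0 hvQ

end Setting

end Real

end Thm311

end IUTFork

end Summit.ABC

end
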